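import Literature.Geometry.Lorentzian.CoordWeightedVectorBoundary
import Literature.Geometry.Lorentzian.CoordFormVectorCauchySchwarz
import HarnessLib

/-!
# The weighted Korn-type inequality at a boundary (Chruściel–Delay 2003, (5.12))

Topic `Literature/Geometry/Lorentzian`, coordinate tensor calculus `MetricCoord` (Riemannian metric
components `G` on an open set `V`). Everything here is PROVED; no definition and no statement of
`Prop` type is introduced.

The first step of the proof of Thm. 5.9 of Chruściel–Delay (Mém. SMF 94 (2003), p. 29): from
Cor. D.5 (`IsMetricOn.integral_boundaryVector`, `CoordWeightedVectorBoundary.lean`) with the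
weight `e^{2s/x} x⁴` (`s > 0`), "taking absolute values of both sides and applying Cauchy–Schwarz
to the left term", one obtains inequality **(5.12)**,
`‖Y‖_{H⁰_{x²,e^{s/x}}} ≤ C ‖x² S(Y)‖_{H⁰_{x²,e^{s/x}}}` for vector fields `Y` supported in a
small collar `{0 < x < x₀}` of the boundary — the vector half of the coercivity estimate (3.4)
("no KIDs supported near the boundary") behind Thm. 5.9 and hence behind the compact-annulus
hypothesis `(E)` of `ChruscielDelay_parametricAnnulusGluing_of_compactCore`.

* (pointwise Cauchy–Schwarz `φ(v)² ≤ φ(♯φ) G(v,v)`, `β(v,w)² ≤ |β|²_G G(v,v) G(w,w)`: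
  `CoordFormVectorCauchySchwarz.lean`);
* **`IsMetricOn.integral_weightedKorn_boundary`** — (5.12) in coordinates: if on the collar
  `{0 < x < x₁}` the defining function satisfies `m ≤ |∇x|² ≤ M₁`, `|Δx| ≤ M₂`,
  `|Hess x(v,v)| ≤ M₃ G(v,v)`, then for `s > 0` there are `x₀ > 0` and `C` such that
  `∫ √det g · e^{2s/x} |Y|²_G dμ ≤ C ∫ √det g · e^{2s/x} x⁴ |S(Y) + ½ tr S(Y) G|²_G dμ`
  for every `Y` smooth on `V` with compact support in `{0 < x < x₀}`
  (Peter–Paul on the pointwise Cauchy–Schwarz bound of `[S + ½ tr S g](Y, x⁻²∇x)` and absorption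
  of the error terms of Cor. D.5 for `x₀` small; `C = 16 M₁/(s m)²`).

## References

* P. T. Chruściel, E. Delay, Mém. Soc. Math. Fr. 94 (2003), proof of Thm. 5.9, (5.12); App. D,
  Cor. D.5. [ChruscielDelay2003]
* B. O'Neill, *Semi-Riemannian geometry*, 1983, Ch. 2, Lemma 2.25. [ONeill1983]
-/

noncomputable section

set_option maxSynthPendingDepth 3

open Set Filter Module Function MeasureTheory
open scoped Topology ContDiff

namespace Literature.Geometry.Lorentzian

namespace MetricCoord

variable {E : Type*} [NormedAddCommGroup E] [NormedSpace ℝ E] [FiniteDimensional ℝ E]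
  [CompleteSpace E] {ι : Type*} [Fintype ι] [DecidableEq ι] (b : Basis ι ℝ E)
  {G : E → E →L[ℝ] E →L[ℝ] ℝ} {V : Set E} {x : E} {Y : E → E}

/-! ### The two real-variable estimates -/

/-- The lower bound of the proof of (5.12): on the collar the integrand of Cor. D.5 dominates
`(s m/4) x⁻⁴ |Y|²`. Pure real arithmetic. [cite: ChruscielDelay2003, Thm. 5.9, (5.12)] -/
private theorem korn_lower_aux {X s m M₁ M₂ M₃ g2 nY dY Hs L : ℝ} (hX : 0 < X) (hX1 : X ≤ 1)
    (hs : 0 < s) (hm : 0 < m) (hM₂ : 0 ≤ M₂) (hM₃ : 0 ≤ M₃)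
    (hXD : X * (6 * M₁ + 2 * M₃ + M₂ + 1) ≤ s * m / 4)
    (hg1 : m ≤ g2) (hg2 : g2 ≤ M₁) (hL : |L| ≤ M₂) (hH : |Hs| ≤ M₃ * nY) (hnY : 0 ≤ nY)
    (hdY : dY ^ 2 ≤ g2 * nY) :
    (s * m / 4) * ((X ^ 4)⁻¹ * nY) ≤
      -((X ^ 4)⁻¹ * ((-s) * (2⁻¹ * g2 * nY + dY ^ 2)
        + X * (2 - 1) * (2⁻¹ * g2 * nY + dY ^ 2) + X ^ 2 * (2⁻¹ * Hs + 4⁻¹ * L * nY))) := by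
  set P : ℝ := 2⁻¹ * g2 * nY + dY ^ 2 with hP
  set Q : ℝ := 2⁻¹ * Hs + 4⁻¹ * L * nY with hQ
  have hX4 : 0 < X ^ 4 := by positivity
  -- bounds on `P` and `Q`
  have hPlo : 2⁻¹ * m * nY ≤ P := by rw [hP]; nlinarith [sq_nonneg dY]
  have hPhi : P ≤ (3 / 2) * M₁ * nY := by rw [hP]; nlinarith
  have hQhi : Q ≤ (2⁻¹ * M₃ + 4⁻¹ * M₂) * nY := by
    rw [hQ]
    have h1 : 2⁻¹ * Hs ≤ 2⁻¹ * M₃ * nY := by linarith [le_abs_self Hs]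
    have h2 : 4⁻¹ * L * nY ≤ 4⁻¹ * M₂ * nY := by
      have := le_abs_self L
      nlinarith
    linarith
  -- the bracket
  have hbr : (s * m / 4) * nY ≤ s * P - X * P - X ^ 2 * Q := by
    have h1 : s * (2⁻¹ * m * nY) ≤ s * P := mul_le_mul_of_nonneg_left hPlo hs.le
    have h2 : X * P ≤ X * ((3 / 2) * M₁ * nY) := mul_le_mul_of_nonneg_left hPhi hX.le
    have h3 : X ^ 2 * Q ≤ X ^ 2 * ((2⁻¹ * M₃ + 4⁻¹ * M₂) * nY) :=
      mul_le_mul_of_nonneg_left hQhi (by positivity)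
    have h4 : X ^ 2 ≤ X := by nlinarith
    have h5 : X ^ 2 * ((2⁻¹ * M₃ + 4⁻¹ * M₂) * nY) ≤ X * ((2⁻¹ * M₃ + 4⁻¹ * M₂) * nY) :=
      mul_le_mul_of_nonneg_right h4 (by positivity)
    have h6 : X * ((3 / 2) * M₁ * nY) + X * ((2⁻¹ * M₃ + 4⁻¹ * M₂) * nY) ≤
        X * (6 * M₁ + 2 * M₃ + M₂ + 1) * nY := by
      have hM₁ : 0 ≤ M₁ := hm.le.trans (hg1.trans hg2)
      calc X * ((3 / 2) * M₁ * nY) + X * ((2⁻¹ * M₃ + 4⁻¹ * M₂) * nY)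
          = X * nY * ((3 / 2) * M₁ + (2⁻¹ * M₃ + 4⁻¹ * M₂)) := by ring
        _ ≤ X * nY * (6 * M₁ + 2 * M₃ + M₂ + 1) :=
            mul_le_mul_of_nonneg_left (by linarith) (by positivity)
        _ = X * (6 * M₁ + 2 * M₃ + M₂ + 1) * nY := by ring
    have h7 : X * (6 * M₁ + 2 * M₃ + M₂ + 1) * nY ≤ (s * m / 4) * nY :=
      mul_le_mul_of_nonneg_right hXD hnY
    nlinarith [h1, h2, h3, h5, h6, h7]
  -- divide by `X⁴`
  have key : (s * m / 4) * ((X ^ 4)⁻¹ * nY) ≤ (X ^ 4)⁻¹ * (s * P - X * P - X ^ 2 * Q) := by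
    rw [show (s * m / 4) * ((X ^ 4)⁻¹ * nY) = (X ^ 4)⁻¹ * ((s * m / 4) * nY) by ring]
    exact mul_le_mul_of_nonneg_left hbr (by positivity)
  calc (s * m / 4) * ((X ^ 4)⁻¹ * nY) ≤ (X ^ 4)⁻¹ * (s * P - X * P - X ^ 2 * Q) := key
    _ = _ := by rw [hP, hQ]; ring

/-- The upper bound of the proof of (5.12): Cauchy–Schwarz input `c² ≤ |T|² (|Y|² |∇x|²)` and
`|∇x|² ≤ M₁` give, by Peter–Paul, `x⁻² c ≤ ½(λ |T|² + λ⁻¹ M₁ x⁻⁴ |Y|²)`. Pure real arithmetic.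
[cite: ChruscielDelay2003, Thm. 5.9, (5.12)] -/
private theorem korn_upper_aux {X c N nY g2 M₁ lam : ℝ} (hX : 0 < X) (hN : 0 ≤ N) (hnY : 0 ≤ nY)
    (hM₁ : 0 ≤ M₁) (hg2 : g2 ≤ M₁) (hlam : 0 < lam) (hCS : c ^ 2 ≤ N * (nY * g2)) :
    (X ^ 2)⁻¹ * c ≤ 2⁻¹ * (lam * N + lam⁻¹ * (M₁ * ((X ^ 4)⁻¹ * nY))) := by
  have hX4 : 0 < X ^ 4 := by positivity
  have hc : ((X ^ 2)⁻¹ * c) ^ 2 ≤ N * (M₁ * ((X ^ 4)⁻¹ * nY)) := by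
    have hX2 : ((X ^ 2)⁻¹) ^ 2 = (X ^ 4)⁻¹ := by rw [← inv_pow]; ring
    calc ((X ^ 2)⁻¹ * c) ^ 2 = (X ^ 4)⁻¹ * c ^ 2 := by rw [mul_pow, hX2]
      _ ≤ (X ^ 4)⁻¹ * (N * (nY * g2)) := mul_le_mul_of_nonneg_left hCS (by positivity)
      _ ≤ (X ^ 4)⁻¹ * (N * (nY * M₁)) := by gcongr
      _ = N * (M₁ * ((X ^ 4)⁻¹ * nY)) := by ring
  exact (le_abs_self _).trans (abs_le_peterPaul hc hN (by positivity) hlam)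

/-! ### Inequality (5.12) -/

section Integral

variable [MeasurableSpace E] [BorelSpace E] (μ : Measure E) [μ.IsAddHaarMeasure]

set_option maxHeartbeats 800000 in
/-- **Inequality (5.12) of Chruściel–Delay 2003** (proof of Thm. 5.9, from Cor. D.5 and
Cauchy–Schwarz), in coordinates. Let `G` be Riemannian metric components on `V` and `x` a smooth
function on `V` with `m ≤ |∇x|² ≤ M₁`, `|Δx| ≤ M₂` and `|Hess x(v,v)| ≤ M₃ G(v,v)` on the collar
`{0 < x < x₁}` (`m > 0`). Then for `s > 0` there are `x₀ > 0` and `C` (`= 16 M₁/(s m)²`) such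
that for every field `Y` smooth on `V` with compact support inside `{0 < x < x₀}`,
`∫ √det g · e^{2s/x} |Y|²_G dμ ≤ C ∫ √det g · e^{2s/x} x⁴ |S(Y) + ½ (tr S(Y)) G|²_G dμ`
(`S(Y) = sym G(∇Y·,·)`, `tr S(Y) = div Y`, `|·|²_G = normSqAt`): vector fields supported near the
boundary are controlled by their Killing operator in the exponentially weighted `L²` norms.
[cite: ChruscielDelay2003, Thm. 5.9, (5.12)] -/
theorem IsMetricOn.integral_weightedKorn_boundary (hG : IsMetricOn G V)
    (hpos : ∀ y ∈ V, ∀ e : E, e ≠ 0 → 0 < G y e e) {xf : E → ℝ} (hxf : ContDiffOn ℝ ∞ xf V)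
    {x₁ m M₁ M₂ M₃ : ℝ} (hx₁ : 0 < x₁) (hm : 0 < m) (hmM : m ≤ M₁) (hM₂ : 0 ≤ M₂) (hM₃ : 0 ≤ M₃)
    (hgrad : ∀ y ∈ V, 0 < xf y → xf y < x₁ → m ≤ gradSqAt G xf y ∧ gradSqAt G xf y ≤ M₁)
    (hlap : ∀ y ∈ V, 0 < xf y → xf y < x₁ → |lapAt G xf y| ≤ M₂)
    (hhess : ∀ y ∈ V, 0 < xf y → xf y < x₁ → ∀ v : E, |hessAt G xf y v v| ≤ M₃ * G y v v)
    {s : ℝ} (hs : 0 < s) :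
    ∃ x₀ : ℝ, 0 < x₀ ∧ ∀ Y : E → E, ContDiffOn ℝ ∞ Y V → HasCompactSupport Y →
      tsupport Y ⊆ {y ∈ V | 0 < xf y ∧ xf y < x₀} →
      ∫ y, sqrtDetGram G b y * (Real.exp (2 * s / xf y) * G y (Y y) (Y y)) ∂μ ≤
        16 * M₁ / (s * m) ^ 2 * ∫ y, sqrtDetGram G b y * (Real.exp (2 * s / xf y) * xf y ^ 4 *
          normSqAt G y (symAt ((G y).comp (covDAt G Y y)) + (2⁻¹ * divAt G Y y) • G y)) ∂μ := by
  -- the collar: `κ = s m/2 − x₀ (3/2) M₁ − x₀² (M₃/2 + M₂/4) ≥ s m/4`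
  have hM₁ : 0 < M₁ := hm.trans_le hmM
  set D : ℝ := 6 * M₁ + 2 * M₃ + M₂ + 1 with hD
  have hD0 : 0 < D := by positivity
  set x₀ : ℝ := min (min 1 x₁) (s * m / (4 * D)) with hx₀
  have hx₀pos : 0 < x₀ := by positivity
  have hx₀1 : x₀ ≤ 1 := (min_le_left _ _).trans (min_le_left _ _)
  have hx₀x₁ : x₀ ≤ x₁ := (min_le_left _ _).trans (min_le_right _ _)
  have hx₀D : x₀ ≤ s * m / (4 * D) := min_le_right _ _
  refine ⟨x₀, hx₀pos, fun Y hY hsupp hYS ↦ ?_⟩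
  set lam : ℝ := 4 * M₁ / (s * m) with hlam
  have hlam0 : 0 < lam := by positivity
  -- notation
  set V' : Set E := {y ∈ V | 0 < xf y} with hV'
  have hV'o : IsOpen V' := hxf.continuousOn.isOpen_inter_preimage hG.isOpen isOpen_Ioi
  have hV'V : V' ⊆ V := fun y hy ↦ hy.1
  have hYV' : tsupport Y ⊆ V' := fun y hy ↦ ⟨(hYS hy).1, (hYS hy).2.1⟩
  have hYV : tsupport Y ⊆ V := hYV'.trans hV'V
  set T : E → E →L[ℝ] E →L[ℝ] ℝ := fun y ↦
    symAt ((G y).comp (covDAt G Y y)) + (2⁻¹ * divAt G Y y) • G y with hTdef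
  set wt : E → ℝ := fun y ↦ Real.exp (2 * (-(-s) / xf y + 2 * Real.log (xf y))) with hwtdef
  have hwt : ∀ y, 0 < xf y → wt y = Real.exp (2 * s / xf y) * xf y ^ 4 := by
    intro y hy
    rw [hwtdef]
    simp only [neg_neg, mul_add, Real.exp_add]
    rw [show 2 * (2 * Real.log (xf y)) = ((4 : ℕ) : ℝ) * Real.log (xf y) by push_cast; ring,
      Real.exp_nat_mul, Real.exp_log hy, mul_div_assoc']
  -- Cor. D.5 with `t = 2`, `s ↦ −s`
  have hD5 := hG.integral_boundaryVector b μ hpos hxf hY hsupp hYV' (-s) 2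
  -- the integrands
  set A : E → ℝ := fun y ↦ wt y * T y (Y y) ((xf y ^ 2)⁻¹ • sharpAt G y (fderiv ℝ xf y)) with hAdef
  set R : E → ℝ := fun y ↦ wt y * ((xf y ^ 4)⁻¹ *
    ((-s) * (2⁻¹ * gradSqAt G xf y * G y (Y y) (Y y) + fderiv ℝ xf y (Y y) ^ 2)
      + xf y * (2 - 1) * (2⁻¹ * gradSqAt G xf y * G y (Y y) (Y y) + fderiv ℝ xf y (Y y) ^ 2)
      + xf y ^ 2 * (2⁻¹ * hessAt G xf y (Y y) (Y y)
        + 4⁻¹ * lapAt G xf y * G y (Y y) (Y y)))) with hRdef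
  set I₀ : E → ℝ := fun y ↦ wt y * ((xf y ^ 4)⁻¹ * G y (Y y) (Y y)) with hI₀def
  set J₀ : E → ℝ := fun y ↦ wt y * normSqAt G y (T y) with hJ₀def
  have hAT : ∀ y, A y = wt y * (symAt ((G y).comp (covDAt G Y y)) (Y y)
      ((xf y ^ 2)⁻¹ • sharpAt G y (fderiv ℝ xf y))
        + 2⁻¹ * divAt G Y y * G y (Y y) ((xf y ^ 2)⁻¹ • sharpAt G y (fderiv ℝ xf y))) := by
    intro y
    simp only [hAdef, hTdef, _root_.add_apply, _root_.smul_apply, smul_eq_mul]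
  have hident : ∫ y, sqrtDetGram G b y * A y ∂μ = -∫ y, sqrtDetGram G b y * R y ∂μ := by
    simp only [hAT, hRdef, hwtdef]
    exact hD5
  -- pointwise bounds on the support
  have hpt : ∀ y ∈ tsupport Y,
      (s * m / 4) * I₀ y ≤ -R y ∧ A y ≤ 2⁻¹ * (lam * J₀ y + lam⁻¹ * M₁ * I₀ y) := by
    intro y hy
    obtain ⟨hyV, hx, hxx₀⟩ := hYS hy
    have hi := hG.isInvertible y hyV
    have hsy := hG.symm y hyV
    have hposy := hpos y hyV
    have hxx₁ : xf y < x₁ := hxx₀.trans_le hx₀x₁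
    have hx1 : xf y ≤ 1 := hxx₀.le.trans hx₀1
    obtain ⟨hg1, hg2⟩ := hgrad y hyV hx hxx₁
    have hL := hlap y hyV hx hxx₁
    have hH := hhess y hyV hx hxx₁ (Y y)
    set X : ℝ := xf y with hX
    set g2 : ℝ := gradSqAt G xf y
    set nY : ℝ := G y (Y y) (Y y) with hnY
    set dY : ℝ := fderiv ℝ xf y (Y y)
    set Hs : ℝ := hessAt G xf y (Y y) (Y y)
    set L : ℝ := lapAt G xf y
    have hnY0 : 0 ≤ nY := by
      by_cases h0 : Y y = 0
      · simp [hnY, h0]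
      · exact (hposy _ h0).le
    have hwt0 : 0 < wt y := by rw [hwt y hx]; positivity
    have hX4 : 0 < X ^ 4 := by positivity
    -- Cauchy–Schwarz for `dx(Y)`
    have hdY : dY ^ 2 ≤ g2 * nY := by
      have h := covector_apply_sq_le hG hyV hposy (fderiv ℝ xf y) (Y y)
      rwa [← gradSqAt_apply] at h
    constructor
    · -- the lower bound for `−R`
      have hXD : X * (6 * M₁ + 2 * M₃ + M₂ + 1) ≤ s * m / 4 := by
        have h1 : X ≤ s * m / (4 * D) := hxx₀.le.trans hx₀D
        calc X * (6 * M₁ + 2 * M₃ + M₂ + 1) = X * D := by rw [hD]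
          _ ≤ s * m / (4 * D) * D := by gcongr
          _ = s * m / 4 := by field_simp
      have key := korn_lower_aux (g2 := g2) (nY := nY) (dY := dY) (Hs := Hs) (L := L)
        hx hx1 hs hm hM₂ hM₃ hXD hg1 hg2 hL hH hnY0 hdY
      calc (s * m / 4) * I₀ y = wt y * ((s * m / 4) * ((X ^ 4)⁻¹ * nY)) := by
            simp only [hI₀def]; ring
        _ ≤ wt y * -((X ^ 4)⁻¹ * ((-s) * (2⁻¹ * g2 * nY + dY ^ 2)
            + X * (2 - 1) * (2⁻¹ * g2 * nY + dY ^ 2) + X ^ 2 * (2⁻¹ * Hs + 4⁻¹ * L * nY))) :=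
            mul_le_mul_of_nonneg_left key hwt0.le
        _ = -R y := by simp only [hRdef]; ring
    · -- the upper bound for `A` (Cauchy–Schwarz and Peter–Paul)
      have hCS := apply_sq_le_normSqAt_mul hG hyV hposy (T y) (Y y) (sharpAt G y (fderiv ℝ xf y))
      rw [apply_sharpAt_apply hi, ← gradSqAt_apply] at hCS
      have hTs : ∀ v w, T y v w = T y w v := by
        intro v w
        simp only [hTdef, _root_.add_apply, _root_.smul_apply, symAt_apply, smul_eq_mul,
          ContinuousLinearMap.comp_apply, hsy v w]
        ring
      have hN0 : 0 ≤ normSqAt G y (T y) := normSqAt_nonneg_of_symm hG hyV hposy hTs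
      have key := korn_upper_aux (c := T y (Y y) (sharpAt G y (fderiv ℝ xf y))) hx hN0 hnY0 hM₁.le
        hg2 hlam0 hCS
      have hA : A y = wt y * ((X ^ 2)⁻¹ * T y (Y y) (sharpAt G y (fderiv ℝ xf y))) := by
        simp only [hAdef, map_smul, smul_eq_mul, hX]
      rw [hA]
      calc wt y * ((X ^ 2)⁻¹ * T y (Y y) (sharpAt G y (fderiv ℝ xf y)))
          ≤ wt y * (2⁻¹ * (lam * normSqAt G y (T y) + lam⁻¹ * (M₁ * ((X ^ 4)⁻¹ * nY)))) :=
            mul_le_mul_of_nonneg_left key hwt0.le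
        _ = 2⁻¹ * (lam * J₀ y + lam⁻¹ * M₁ * I₀ y) := by simp only [hJ₀def, hI₀def]; ring
  -- integrability (all integrands are smooth on the collar and vanish with `Y`)
  have hG' : IsMetricOn G V' :=
    ⟨hV'o, hG.contDiffOn.mono hV'V, fun y hy ↦ hG.symm y (hV'V hy), fun y hy ↦ hG.isInvertible y (hV'V hy)⟩
  have hpos' : ∀ y ∈ V', ∀ e : E, e ≠ 0 → 0 < G y e e := fun y hy ↦ hpos y hy.1
  have hne : ∀ y ∈ V', xf y ≠ 0 := fun y hy ↦ hy.2.ne'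
  have hxf' : ContDiffOn ℝ ∞ xf V' := hxf.mono hV'V
  have hY' : ContDiffOn ℝ ∞ Y V' := hY.mono hV'V
  have hwts : ContDiffOn ℝ ∞ wt V' := by
    have h1 : ContDiffOn ℝ ∞ (fun y ↦ (xf y)⁻¹) V' := hxf'.inv hne
    have h2 : ContDiffOn ℝ ∞ (fun y ↦ Real.log (xf y)) V' := hxf'.log hne
    have h : ContDiffOn ℝ ∞ (fun y ↦ -(-s) / xf y + 2 * Real.log (xf y)) V' := by
      refine ((h1.const_smul (-(-s))).add (h2.const_smul (2 : ℝ))).congr fun y _ ↦ ?_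
      simp only [smul_eq_mul, div_eq_mul_inv]
    exact (contDiffOn_const.mul h).exp
  have hnYs : ContDiffOn ℝ ∞ (fun y ↦ G y (Y y) (Y y)) V' := (hG'.contDiffOn.clm_apply hY').clm_apply hY'
  have hTs : ContDiffOn ℝ ∞ T V' :=
    (contDiffOn_symAt (hG'.contDiffOn.clm_comp (hG'.contDiffOn_covDAt hY'))).add
      ((contDiffOn_const.mul (hG'.contDiffOn_divAt hY')).smul hG'.contDiffOn)
  have hI₀s : ContDiffOn ℝ ∞ I₀ V' :=
    hwts.mul (((hxf'.pow 4).inv fun y hy ↦ pow_ne_zero 4 (hne y hy)).mul hnYs)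
  have hJ₀s : ContDiffOn ℝ ∞ J₀ V' := hwts.mul (hG'.contDiffOn_normSqAt hTs)
  -- off the support `Y` vanishes to first order, so all four integrands vanish there
  have hY0 : ∀ z ∉ tsupport Y, Y z = 0 ∧ fderiv ℝ Y z = 0 := by
    intro z hz
    have hzu : Y =ᶠ[𝓝 z] fun _ ↦ 0 := notMem_tsupport_iff_eventuallyEq.mp hz
    exact ⟨hzu.self_of_nhds, by rw [hzu.fderiv_eq, fderiv_fun_const]; rfl⟩
  have hT0 : ∀ z, Y z = 0 → fderiv ℝ Y z = 0 → T z = 0 := by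
    intro z hz hdz
    have hcov : covDAt G Y z = 0 := by
      ext v; simp only [covDAt_apply, hz, hdz, map_zero, _root_.zero_apply, add_zero]
    have hdiv : divAt G Y z = 0 := by rw [divAt_eq, hcov, map_zero]
    simp only [hTdef, hcov, hdiv, ContinuousLinearMap.comp_zero, mul_zero, zero_smul, add_zero]
    ext v w; simp [symAt_apply]
  have hnorm0 : ∀ z, normSqAt G z (0 : E →L[ℝ] E →L[ℝ] ℝ) = 0 := fun z ↦ by
    simp [normSqAt_eq_traceCLM]
  have hI₀0 : ∀ z, Y z = 0 → fderiv ℝ Y z = 0 → I₀ z = 0 := fun z hz _ ↦ by simp [hI₀def, hz]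
  have hJ₀0 : ∀ z, Y z = 0 → fderiv ℝ Y z = 0 → J₀ z = 0 := fun z hz hdz ↦ by
    simp only [hJ₀def, hT0 z hz hdz, hnorm0, mul_zero]
  have hA0 : ∀ z, Y z = 0 → fderiv ℝ Y z = 0 → A z = 0 := fun z hz hdz ↦ by
    simp only [hAdef, hT0 z hz hdz, _root_.zero_apply, mul_zero]
  have hR0 : ∀ z, Y z = 0 → fderiv ℝ Y z = 0 → R z = 0 := fun z hz _ ↦ by
    simp only [hRdef, hz, map_zero, mul_zero, add_zero, zero_pow two_ne_zero]
  -- integrability: continuous with compact support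
  have hsg : ContDiffOn ℝ ∞ (sqrtDetGram G b) V' := hG'.contDiffOn_sqrtDetGram b hpos'
  have hInt : ∀ {k : E → ℝ}, ContDiffOn ℝ ∞ k V' → (∀ z, Y z = 0 → fderiv ℝ Y z = 0 → k z = 0) →
      Integrable (fun z ↦ sqrtDetGram G b z * k z) μ := by
    intro k hk hk0
    have hcont : Continuous fun z ↦ sqrtDetGram G b z * k z := by
      refine continuous_iff_continuousAt.2 fun y ↦ ?_
      by_cases hy : y ∈ tsupport Y
      · have hyV' := hYV' hy
        exact ((hsg.continuousOn.continuousWithinAt hyV').continuousAt (hV'o.mem_nhds hyV')).mul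
          ((hk.continuousOn.continuousWithinAt hyV').continuousAt (hV'o.mem_nhds hyV'))
      · have hzu : Y =ᶠ[𝓝 y] fun _ ↦ 0 := notMem_tsupport_iff_eventuallyEq.mp hy
        obtain ⟨U, hU, hUo, hyU⟩ := mem_nhds_iff.1 hzu
        have hev : (fun z ↦ sqrtDetGram G b z * k z) =ᶠ[𝓝 y] fun _ ↦ 0 := by
          filter_upwards [hUo.mem_nhds hyU] with z hz
          have hzY : Y =ᶠ[𝓝 z] fun _ ↦ 0 :=
            Filter.eventually_of_mem (hUo.mem_nhds hz) fun t ht ↦ hU ht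
          rw [hk0 z hzY.self_of_nhds (by rw [hzY.fderiv_eq, fderiv_fun_const]; rfl), mul_zero]
        exact (continuousAt_const.congr_of_eventuallyEq hev :)
    refine hcont.integrable_of_hasCompactSupport (hsupp.mono' fun y hy ↦ ?_)
    by_contra hyY
    exact hy (show sqrtDetGram G b y * k y = 0 by rw [hk0 y (hY0 y hyY).1 (hY0 y hyY).2, mul_zero])
  have hAs : ContDiffOn ℝ ∞ A V' := by
    refine hwts.mul ((hTs.clm_apply hY').clm_apply ?_)
    exact ((hxf'.pow 2).inv fun y hy ↦ pow_ne_zero 2 (hne y hy)).smul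
      (hG'.contDiffOn_sharpAt.clm_apply (hxf'.fderiv_of_isOpen hV'o (by simp)))
  have hRs : ContDiffOn ℝ ∞ R V' := by
    have hdxf : ContDiffOn ℝ ∞ (fderiv ℝ xf) V' := hxf'.fderiv_of_isOpen hV'o (by simp)
    have hP : ContDiffOn ℝ ∞ (fun y ↦ 2⁻¹ * gradSqAt G xf y * G y (Y y) (Y y)
        + fderiv ℝ xf y (Y y) ^ 2) V' :=
      ((contDiffOn_const.mul (hG'.contDiffOn_gradSqAt hxf')).mul hnYs).add ((hdxf.clm_apply hY').pow 2)
    have hQ : ContDiffOn ℝ ∞ (fun y ↦ 2⁻¹ * hessAt G xf y (Y y) (Y y)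
        + 4⁻¹ * lapAt G xf y * G y (Y y) (Y y)) V' :=
      (contDiffOn_const.mul (((hG'.contDiffOn_hessAt hxf').clm_apply hY').clm_apply hY')).add
        ((contDiffOn_const.mul (hG'.contDiffOn_lapAt hxf')).mul hnYs)
    refine hwts.mul (((hxf'.pow 4).inv fun y hy ↦ pow_ne_zero 4 (hne y hy)).mul ?_)
    exact ((contDiffOn_const.mul hP).add (((hxf'.mul contDiffOn_const)).mul hP)).add
      ((hxf'.pow 2).mul hQ)
  have hII := hInt hI₀s hI₀0
  have hIJ := hInt hJ₀s hJ₀0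
  have hIA := hInt hAs hA0
  have hIR := hInt hRs hR0
  -- integrate the pointwise bounds
  have h1 : (s * m / 4) * ∫ y, sqrtDetGram G b y * I₀ y ∂μ ≤ -∫ y, sqrtDetGram G b y * R y ∂μ := by
    rw [← integral_const_mul, ← integral_neg]
    refine integral_mono (hII.const_mul _) hIR.neg fun y ↦ ?_
    show s * m / 4 * (sqrtDetGram G b y * I₀ y) ≤ -(sqrtDetGram G b y * R y)
    by_cases hy : y ∈ tsupport Y
    · have h := mul_le_mul_of_nonneg_left (hpt y hy).1 (Real.sqrt_nonneg (gramMatrix G b y).det)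
      calc s * m / 4 * (sqrtDetGram G b y * I₀ y) = sqrtDetGram G b y * ((s * m / 4) * I₀ y) := by ring
        _ ≤ sqrtDetGram G b y * (-R y) := h
        _ = -(sqrtDetGram G b y * R y) := by ring
    · rw [hI₀0 y (hY0 y hy).1 (hY0 y hy).2, hR0 y (hY0 y hy).1 (hY0 y hy).2]; simp
  have h2 : ∫ y, sqrtDetGram G b y * A y ∂μ ≤
      2⁻¹ * (lam * ∫ y, sqrtDetGram G b y * J₀ y ∂μ + lam⁻¹ * M₁ * ∫ y, sqrtDetGram G b y * I₀ y ∂μ) := by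
    rw [← integral_const_mul, ← integral_const_mul, ← integral_add (hIJ.const_mul _) (hII.const_mul _),
      ← integral_const_mul]
    refine integral_mono hIA (((hIJ.const_mul _).add (hII.const_mul _)).const_mul _) fun y ↦ ?_
    show sqrtDetGram G b y * A y ≤
      2⁻¹ * (lam * (sqrtDetGram G b y * J₀ y) + lam⁻¹ * M₁ * (sqrtDetGram G b y * I₀ y))
    by_cases hy : y ∈ tsupport Y
    · have h := mul_le_mul_of_nonneg_left (hpt y hy).2 (Real.sqrt_nonneg (gramMatrix G b y).det)
      calc sqrtDetGram G b y * A y ≤ sqrtDetGram G b y * (2⁻¹ * (lam * J₀ y + lam⁻¹ * M₁ * I₀ y)) := h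
        _ = 2⁻¹ * (lam * (sqrtDetGram G b y * J₀ y) + lam⁻¹ * M₁ * (sqrtDetGram G b y * I₀ y)) := by
            ring
    · rw [hA0 y (hY0 y hy).1 (hY0 y hy).2, hJ₀0 y (hY0 y hy).1 (hY0 y hy).2,
        hI₀0 y (hY0 y hy).1 (hY0 y hy).2]
      simp
  -- absorb: with `lam = 4 M₁/(s m)`, `lam⁻¹ M₁ /2 = s m / 8`
  set II : ℝ := ∫ y, sqrtDetGram G b y * I₀ y ∂μ with hIIdef
  set JJ : ℝ := ∫ y, sqrtDetGram G b y * J₀ y ∂μ with hJJdef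
  have hsm : 0 < s * m := by positivity
  have hlamM : lam⁻¹ * M₁ = s * m / 4 := by rw [hlam]; field_simp
  have h3 : (s * m / 4) * II ≤ 2⁻¹ * (lam * JJ + (s * m / 4) * II) := by
    rw [hlamM] at h2
    linarith [h1, h2, hident]
  have h4 : II ≤ 16 * M₁ / (s * m) ^ 2 * JJ := by
    have h5 : (s * m / 8) * II ≤ 2⁻¹ * lam * JJ := by linarith
    have h6 : II ≤ (2⁻¹ * lam) / (s * m / 8) * JJ := by
      rw [div_mul_eq_mul_div, le_div_iff₀ (by positivity)]
      linarith
    calc II ≤ (2⁻¹ * lam) / (s * m / 8) * JJ := h6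
      _ = 16 * M₁ / (s * m) ^ 2 * JJ := by rw [hlam]; field_simp; ring
  -- rewrite the two integrals in the printed weights
  have hIIeq : II = ∫ y, sqrtDetGram G b y * (Real.exp (2 * s / xf y) * G y (Y y) (Y y)) ∂μ := by
    refine integral_congr_ae (Eventually.of_forall fun y ↦ ?_)
    show sqrtDetGram G b y * I₀ y = _
    by_cases hy : y ∈ tsupport Y
    · have hx : 0 < xf y := (hYS hy).2.1
      simp only [hI₀def, hwt y hx]
      field_simp
    · simp [hI₀def, (hY0 y hy).1]
  have hJJeq : JJ = ∫ y, sqrtDetGram G b y * (Real.exp (2 * s / xf y) * xf y ^ 4 *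
      normSqAt G y (symAt ((G y).comp (covDAt G Y y)) + (2⁻¹ * divAt G Y y) • G y)) ∂μ := by
    refine integral_congr_ae (Eventually.of_forall fun y ↦ ?_)
    show sqrtDetGram G b y * J₀ y = _
    by_cases hy : y ∈ tsupport Y
    · have hx : 0 < xf y := (hYS hy).2.1
      simp only [hJ₀def, hwt y hx, hTdef]
    · have h := hT0 y (hY0 y hy).1 (hY0 y hy).2
      simp only [hTdef] at h
      simp only [hJ₀def, hTdef, h, hnorm0, mul_zero]
  rw [← hIIeq, ← hJJeq]
  exact h4

end Integral

end MetricCoord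

end Literature.Geometry.Lorentzian

end
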